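import Summits.QuantumFields.YangMills.Theorems.BalabanUVNodesN07HalvingBudgetConstants
import HarnessLib


/-!
# N07 [B11] (= [15] = [Balaban1985Variational]) Sect. F, road of record R0′, S6 HEAD: **THE BUDGET FOR AFFINE LETTERS** — the ranged `HBUDGET` hypothesis of the knit
# (`…N07SplitClauseHeadKnitRanged.datumGaugeSplitTopStepCoreG_of_prop6P_of_chartR`) holds, with EXPLICIT `C θ Q`, as soon as the chart lane's size letters at a level are
# affine in `(δ_j, ε_j, ε_j²)` with non-negative coefficients — print's shape of every (160)∕(155)∕(157)∕(164)∕(165) estimate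

Cell `pub-ymgap`, width seat `pub-ymgap-dag-n07-w4` g4 (sub-target S6 = the HEAD), CLAIM-8 ∕ INTENT-8 (cell bus).  `--kind proof --supports stmt-QuantumFields-27364 --as helper`
(K1⁹ per dag-lead KEY MAP v2); count-neutral; def-free; pure real arithmetic.  [15] = [Balaban1985Variational].

THE POINT.  The knit's ranged budget asks, at a level with `0 < δ`, `0 ≤ ε`: thresholds `t₂ > ¼M′·max{4C_HB_H·β₁, θ_H·β₂∕M′}`, `t₃ > ¼·max{4C_HB_H·s′, θ_H·s′}`,
`t_∂ > 2C_SB_S·(4σ)` with `t₁ + (t₂ + t_∂) + t₃ ≤ Cδ + θε + Qε²`.  If `β₁, β₂, s′, σ, t₁` are affine, `x = x₁δ + x₂ε + x₃ε²` with `x_i ≥ 0`, then (`max{a, b} ≤ a + b` for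
`a, b ≥ 0`, slack `δ∕3` on each strict threshold) the budget holds with
`C := M′C_HB_H·b₁₁ + ¼θ_H·b₂₁ + (C_HB_H + ¼θ_H)·s₁ + 8C_SB_S·σ₁ + q₁ + 1`, `θ := (same with index 2)`, `Q := (same with index 3)` — explicit, monotone in every coefficient, so
the (162)–(166♭) smallness `4C ≤ B₃`, `16θ ≤ 1` become inequalities on the chart lane's coefficients ((166♭): the `ε`-coefficients `b₁₂, b₂₂, s₂, σ₂, q₂` must be small,
`θ_H` small by the (163) collar).

WHAT IS PROVED (sorry-free; no definition; axioms standard).  `max_le_add_of_nonneg`; ★★ `budget_affine` (statement above, one level, all letters real numbers); ★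
`budget_affine_fun` (the same for letter FUNCTIONS of `(ε, δ, j)` given coefficientwise — the literal shape of the knit's ranged `HBUDGET` binder at `M′ := sideP`, for a
consumer to `intro K ε δ j h₁ h₂ h₃ h₄; exact budget_affine_fun …`).
HONEST SCOPE.  Elementary real arithmetic; nothing of [15] asserted; whether the chart lane's letters ARE affine with these coefficients is THEIR theorem (BRIDGE-92, (157),
(164)); the smallness of the resulting `C θ Q` is NOT claimed; no token ∕ stub ∕ K-item closed; N07 NOT discharged; counts unmoved (typed 28∕28 · discharged 5∕27); one finite 𝕋⁴
programme at fixed ε — the route closes the conditional finite-𝕋⁴ rung `BalabanLadder.UV` ONLY; the YM mass gap (Clay) is NOT proved by any of this; nothing continuum ∕ ℝ⁴ ∕ OS.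
No `sorry`, no `def`, no `instance`, no `notation`.

RELATED IN THE TREE, NOT DUPLICATED: dag-n07-w4 g3 `N07HalvingBudgetConstants.exists_halvingBudget` and n07-w3 g7 `N07HalvingBudgetS3.exists_halvingBudget_S3_guard` (the ORDER
OF CHOICES `ρ → (c, c₀) → B₃ → a₀` AFTER `C θ Q` are known — complementary: this file PRODUCES `C θ Q` from affine letters); FILE 7 `N07SplitClauseHeadKnitRanged` (the consumer
of `HBUDGET`).

References: [15] (160)–(161) p. 303, (162)–(166) pp. 303–304, (165) p. 304 («B₃(C₀δ + … )»-type thresholds).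
-/

set_option autoImplicit false

noncomputable section

namespace Summit.QuantumFields.YangMills.BalabanUVNodes.N07SplitClauseHeadBudgetAffine

/-- `max a b ≤ a + b` for `a, b ≥ 0`. [folklore] -/
theorem max_le_add_of_nonneg {a b : ℝ} (ha : 0 ≤ a) (hb : 0 ≤ b) : max a b ≤ a + b :=
  max_le (le_add_of_nonneg_right hb) (le_add_of_nonneg_left ha)

/-- ★★ **THE BUDGET FOR AFFINE LETTERS, ONE LEVEL**: with `M′ > 0`, door constants `C_H B_H θ_H ≥ 0` (any `C_S B_S`), letters `β₁ β₂ s′ t₁` affine in `(δ, ε, ε²)` with non-negative coefficients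
(`σ` affine, any signs), `0 < δ`, `0 ≤ ε`: thresholds `t₂ t₃ t_∂` above the doors' floors exist with `t₁ + (t₂ + t_∂) + t₃ ≤ Cδ + θε + Qε²` for the EXPLICIT
`C = M′C_HB_Hb₁₁ + ¼θ_Hb₂₁ + (C_HB_H + ¼θ_H)s₁ + 8C_SB_Sσ₁ + q₁ + 1`, `θ, Q` likewise (indices 2, 3, no `+1`).
[cite: Balaban1985Variational, (165) p.304, (162)–(166) pp.303–304 (bookkeeping)] -/
theorem budget_affine {M' CH BH θH CS BS : ℝ} (hM' : 0 < M') (hCH : 0 ≤ CH) (hBH : 0 ≤ BH) (hθH : 0 ≤ θH)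
    {b₁₁ b₁₂ b₁₃ b₂₁ b₂₂ b₂₃ s₁ s₂ s₃ σ₁ σ₂ σ₃ q₁ q₂ q₃ : ℝ}
    (hb₁₁ : 0 ≤ b₁₁) (hb₁₂ : 0 ≤ b₁₂) (hb₁₃ : 0 ≤ b₁₃) (hb₂₁ : 0 ≤ b₂₁) (hb₂₂ : 0 ≤ b₂₂) (hb₂₃ : 0 ≤ b₂₃)
    (hs₁ : 0 ≤ s₁) (hs₂ : 0 ≤ s₂) (hs₃ : 0 ≤ s₃)
    {δ ε : ℝ} (hδ : 0 < δ) (hε : 0 ≤ ε) :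
    ∃ t₂ t₃ tD : ℝ,
      1 / 4 * M' * max (4 * CH * BH * (b₁₁ * δ + b₁₂ * ε + b₁₃ * ε ^ 2)) (θH * ((b₂₁ * δ + b₂₂ * ε + b₂₃ * ε ^ 2) / M')) < t₂ ∧
      1 / 4 * max (4 * CH * BH * (s₁ * δ + s₂ * ε + s₃ * ε ^ 2)) (θH * (s₁ * δ + s₂ * ε + s₃ * ε ^ 2)) < t₃ ∧
      2 * CS * BS * (4 * (σ₁ * δ + σ₂ * ε + σ₃ * ε ^ 2)) < tD ∧
      (q₁ * δ + q₂ * ε + q₃ * ε ^ 2) + (t₂ + tD) + t₃ ≤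
        (M' * CH * BH * b₁₁ + 1 / 4 * θH * b₂₁ + (CH * BH + 1 / 4 * θH) * s₁ + 8 * CS * BS * σ₁ + q₁ + 1) * δ +
        (M' * CH * BH * b₁₂ + 1 / 4 * θH * b₂₂ + (CH * BH + 1 / 4 * θH) * s₂ + 8 * CS * BS * σ₂ + q₂) * ε +
        (M' * CH * BH * b₁₃ + 1 / 4 * θH * b₂₃ + (CH * BH + 1 / 4 * θH) * s₃ + 8 * CS * BS * σ₃ + q₃) * ε ^ 2 := by
  have hε2 : 0 ≤ ε ^ 2 := sq_nonneg ε
  set B1 := b₁₁ * δ + b₁₂ * ε + b₁₃ * ε ^ 2 with hB1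
  set B2 := b₂₁ * δ + b₂₂ * ε + b₂₃ * ε ^ 2 with hB2
  set S := s₁ * δ + s₂ * ε + s₃ * ε ^ 2 with hS
  set Sg := σ₁ * δ + σ₂ * ε + σ₃ * ε ^ 2 with hSg
  have hB1n : 0 ≤ B1 := by rw [hB1]; positivity
  have hB2n : 0 ≤ B2 := by rw [hB2]; positivity
  have hSn : 0 ≤ S := by rw [hS]; positivity
  have hCB : 0 ≤ CH * BH := mul_nonneg hCH hBH
  -- the two `max`es by sums
  have hX₂ : 1 / 4 * M' * max (4 * CH * BH * B1) (θH * (B2 / M')) ≤ M' * CH * BH * B1 + 1 / 4 * θH * B2 := by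
    have hm := max_le_add_of_nonneg (by positivity : 0 ≤ 4 * CH * BH * B1) (by positivity : 0 ≤ θH * (B2 / M'))
    have hM0 : 0 ≤ 1 / 4 * M' := by positivity
    calc 1 / 4 * M' * max (4 * CH * BH * B1) (θH * (B2 / M'))
        ≤ 1 / 4 * M' * (4 * CH * BH * B1 + θH * (B2 / M')) := mul_le_mul_of_nonneg_left hm hM0
      _ = M' * CH * BH * B1 + 1 / 4 * θH * B2 := by field_simp
  have hX₃ : 1 / 4 * max (4 * CH * BH * S) (θH * S) ≤ (CH * BH + 1 / 4 * θH) * S := by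
    have hm := max_le_add_of_nonneg (by positivity : 0 ≤ 4 * CH * BH * S) (by positivity : 0 ≤ θH * S)
    calc 1 / 4 * max (4 * CH * BH * S) (θH * S) ≤ 1 / 4 * (4 * CH * BH * S + θH * S) := by
          exact mul_le_mul_of_nonneg_left hm (by norm_num)
      _ = (CH * BH + 1 / 4 * θH) * S := by ring
  refine ⟨1 / 4 * M' * max (4 * CH * BH * B1) (θH * (B2 / M')) + δ / 3, 1 / 4 * max (4 * CH * BH * S) (θH * S) + δ / 3,
    2 * CS * BS * (4 * Sg) + δ / 3, by linarith, by linarith, by linarith, ?_⟩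
  have hexp : (M' * CH * BH * b₁₁ + 1 / 4 * θH * b₂₁ + (CH * BH + 1 / 4 * θH) * s₁ + 8 * CS * BS * σ₁ + q₁ + 1) * δ +
        (M' * CH * BH * b₁₂ + 1 / 4 * θH * b₂₂ + (CH * BH + 1 / 4 * θH) * s₂ + 8 * CS * BS * σ₂ + q₂) * ε +
        (M' * CH * BH * b₁₃ + 1 / 4 * θH * b₂₃ + (CH * BH + 1 / 4 * θH) * s₃ + 8 * CS * BS * σ₃ + q₃) * ε ^ 2 =
      (q₁ * δ + q₂ * ε + q₃ * ε ^ 2) + (M' * CH * BH * B1 + 1 / 4 * θH * B2) + (CH * BH + 1 / 4 * θH) * S + 8 * CS * BS * Sg + δ := by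
    rw [hB1, hB2, hS, hSg]; ring
  rw [hexp]
  have h8 : 2 * CS * BS * (4 * Sg) = 8 * CS * BS * Sg := by ring
  linarith

/-- ★ **THE SAME FOR LETTER FUNCTIONS OF `(ε, δ, j)`** — the literal shape of the knit's ranged `HBUDGET` binder at one `(ε, δ, j)` with `M′ := sideP …` cast: if the letters
`β₁ β₂ s′ σ t₁ : (ℕ → ℝ) → (ℕ → ℝ) → ℕ → ℝ` are affine in `(δ j, ε j, (ε j)²)` with the given non-negative coefficients AT `(ε, δ, j)`, the thresholds exist with the explicit
`C θ Q` of `budget_affine` (`0 < δ j`; `0 ≤ ε j` follows from `B₃·δ j ≤ ε j`, `0 < B₃`). [cite: Balaban1985Variational, (165) p.304, (162)–(166) pp.303–304 (bookkeeping)] -/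
theorem budget_affine_fun {M' CH BH θH CS BS : ℝ} (hM' : 0 < M') (hCH : 0 ≤ CH) (hBH : 0 ≤ BH) (hθH : 0 ≤ θH)
    {b₁₁ b₁₂ b₁₃ b₂₁ b₂₂ b₂₃ s₁ s₂ s₃ σ₁ σ₂ σ₃ q₁ q₂ q₃ : ℝ}
    (hb₁₁ : 0 ≤ b₁₁) (hb₁₂ : 0 ≤ b₁₂) (hb₁₃ : 0 ≤ b₁₃) (hb₂₁ : 0 ≤ b₂₁) (hb₂₂ : 0 ≤ b₂₂) (hb₂₃ : 0 ≤ b₂₃)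
    (hs₁ : 0 ≤ s₁) (hs₂ : 0 ≤ s₂) (hs₃ : 0 ≤ s₃)
    (β₁ β₂ s' σ t₁ : (ℕ → ℝ) → (ℕ → ℝ) → ℕ → ℝ) (ε δ : ℕ → ℝ) (j : ℕ)
    (hβ₁ : β₁ ε δ j = b₁₁ * δ j + b₁₂ * ε j + b₁₃ * ε j ^ 2) (hβ₂ : β₂ ε δ j = b₂₁ * δ j + b₂₂ * ε j + b₂₃ * ε j ^ 2)
    (hs' : s' ε δ j = s₁ * δ j + s₂ * ε j + s₃ * ε j ^ 2) (hσ : σ ε δ j = σ₁ * δ j + σ₂ * ε j + σ₃ * ε j ^ 2)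
    (ht₁ : t₁ ε δ j = q₁ * δ j + q₂ * ε j + q₃ * ε j ^ 2)
    {B₃ : ℝ} (hB₃ : 0 < B₃) (hδ : 0 < δ j) (hεδ : B₃ * δ j ≤ ε j) :
    ∃ t₂ t₃ tD : ℝ,
      1 / 4 * M' * max (4 * CH * BH * β₁ ε δ j) (θH * (β₂ ε δ j / M')) < t₂ ∧
      1 / 4 * max (4 * CH * BH * s' ε δ j) (θH * s' ε δ j) < t₃ ∧ 2 * CS * BS * (4 * σ ε δ j) < tD ∧
      t₁ ε δ j + (t₂ + tD) + t₃ ≤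
        (M' * CH * BH * b₁₁ + 1 / 4 * θH * b₂₁ + (CH * BH + 1 / 4 * θH) * s₁ + 8 * CS * BS * σ₁ + q₁ + 1) * δ j +
        (M' * CH * BH * b₁₂ + 1 / 4 * θH * b₂₂ + (CH * BH + 1 / 4 * θH) * s₂ + 8 * CS * BS * σ₂ + q₂) * ε j +
        (M' * CH * BH * b₁₃ + 1 / 4 * θH * b₂₃ + (CH * BH + 1 / 4 * θH) * s₃ + 8 * CS * BS * σ₃ + q₃) * ε j ^ 2 := by
  have hε : 0 ≤ ε j := le_trans (mul_pos hB₃ hδ).le hεδ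
  rw [hβ₁, hβ₂, hs', hσ, ht₁]
  exact budget_affine hM' hCH hBH hθH hb₁₁ hb₁₂ hb₁₃ hb₂₁ hb₂₂ hb₂₃ hs₁ hs₂ hs₃ hδ hε

end Summit.QuantumFields.YangMills.BalabanUVNodes.N07SplitClauseHeadBudgetAffine

end
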